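import Summits.QuantumFields.YangMills.Theorems.FluctuationComparisonRegPrIntLS2BetaChartReadDescentOntoExpPoint
import HarnessLib

/-!
# S2β · THE PINNED `DM`, FACTORISED: `D(Mc)(0) = L_σ ∘ DΨ_{K−J}(0) ∘ E` — the derivative of the door's charted descent (px5 g22 ✓`…S2BetaCritMOfChartReadDescent`'s `DM`,
# the object (RINV-curl) ∕ AVG₂♭-ax quantify) IS the k-step chart-read derivative of ✓p823800 read through the bond reindexing `L_σ` and the coordinate `E : ℝ³ ≅ 𝔰𝔲(2)`

Cell `ym3-torus` (YM ladder rung R3 = continuum `SU(2)` Yang–Mills on the three-torus at fixed lattice data — a RUNG: NOT d = 4, NOT infinite volume, NOT a mass gap,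
NOT Clay).  Width seat `ym3-torus-px13` (gen 25); crux `stmt-QuantumFields-20520`, LINE g18-1 S2β; `--kind proof --supports stmt-QuantumFields-20520 --as helper`, count-neutral,
DEFINITION-FREE (0 `def`, 0 `instance`, 0 `notation`, 0 `sorry`).  FILE B ∕ FILE C prove `C^∞` + ONTO for the T³ ∕ quaternionic charted descents by composing with `L_σ` and `E`
INSIDE their proofs; the (RINV-curl) discharger (px16 g21, RINV-cov) and AVG₂♭-ax (px10 g23) need the COMPOSITION FORMULAS THEMSELVES to read `DM ζ` level by level through
(D0) ✓`…ChartReadDescentChainRule` and (D1) ✓`…ChartReadDerivCovLinAvg`.  THIS FILE exports them.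

WHAT IS PROVED (sorry-free).
* §1 ★★`fderiv_chartRead_descendTo_eq` — T³ log chart: **`fderiv ℝ Mc_log 0 = L_σ ∘L fderiv ℝ Ψ_{K−J} 0`** (`L_σ := ContinuousLinearMap.pi (B ↦ proj (bondShift _ B))`; guard only:
  `U₀ ∈ histGood F ℰp θ K J`, `0 ≤ θ`, `(5L)²∕4·θ_i < δ_{SU(2)}` on `(J, K]`); `fderiv_chartRead_descendTo_apply` (pointwise: `(D Mc_log(0) A) B = (DΨ_{K−J}(0) A) (bondShift _ B)`).
* §2 ★★`fderiv_chartRead_descendTo_expPoint_eq` — the door's chart: for EVERY coordinate equivalence `E` with `E ζ b = ⟨su2Coord (rev (ζ b)), _⟩` (✓`exists_coordEquiv`):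
  **`fderiv ℝ Mc 0 = (fderiv ℝ Mc_log 0) ∘L ↑E`**, hence ★★★`fderiv_chartRead_descendTo_expPoint_apply` — **`(DM ζ) B = (DΨ_{K−J}(0) (b ↦ ⟨su2Coord (rev (ζ b)), _⟩)) (bondShift _ B)`**
  (no `E` in the statement).

HONEST.  Chain rule through a linear reindexing and a linear coordinate change; nothing of Bałaban's; (RINV-curl) ∕ RINV-cov ∕ MULT♮ ∕ AVG₂♭ ∕ «CRIT-ax» ∕ (D-ax) ∕ GAP♯∘ (registry
UNTOUCHED) ∕ five REGISTERED stubs ∕ S2β ∕ 20520 ∕ 19936 ∕ 19200 ∕ `YM3TorusSU2` NOT proved; no summit statement is proved by a helper; rung R3 = SU(2) YM₃ on T³ — NOT d = 4,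
NOT infinite volume, NOT a mass gap, NOT Clay; the Yang–Mills mass gap is NOT proved.  Axioms standard.

References: T. Bałaban, CMP **109** (1987) 249–301 [Balaban1987RG1] ((0.1) p.251, (0.11) p.253); CMP **102** (1985) 255–275 [Balaban1985UV3] (p.260: the chart `A ↦ exp iA`).
-/

set_option autoImplicit false

noncomputable section

open scoped Matrix.Norms.L2Operator Topology
open Filter Set Function

namespace Summit.QuantumFields.YangMills.Theorems.FluctuationComparisonRegPrIntLS2BetaChartReadDescentDerivFactorisation

open Literature.MathematicalPhysics.QuantumFieldTheory.Balaban1983to89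
open Literature.MathematicalPhysics.QuantumFieldTheory.Balaban1983to89.HaarExponentialChart
open Literature.MathematicalPhysics.QuantumFieldTheory.Balaban1983to89.HaarExponentialChart.IsChartRep
open Literature.MathematicalPhysics.QuantumFieldTheory.Balaban1983to89.BlockAveraging (Small Idx avgFun loopHol blockAvg blockAvg_avg)
open Literature.MathematicalPhysics.QuantumFieldTheory.Balaban1983to89.ExpMeanLog (expMeanLogSU deltaSU)
open Literature.MathematicalPhysics.QuantumFieldTheory.Balaban1983to89.Node00
open Literature.MathematicalPhysics.QuantumFieldTheory.Balaban1983to89.T3ContinuumYM3Torus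
open Literature.MathematicalPhysics.QuantumFieldTheory.Balaban1983to89.T3UnitLawDensityEML (ℰp)
open Literature.MathematicalPhysics.QuantumFieldTheory.Balaban1983to89.T3UnitScaleTilt
open Literature.MathematicalPhysics.QuantumFieldTheory.Balaban1983to89.T3TiltDescent
open Literature.MathematicalPhysics.QuantumFieldTheory.Balaban1983to89.T3LevelShift (fieldShift bondShift)
open Literature.MathematicalPhysics.QuantumFieldTheory.Balaban1983to89.T4HaarSU2ExpChart (expPoint expPoint_zero)
open Literature.MathematicalPhysics.QuantumFieldTheory.Balaban1983to89.B10Eq18SigmaSU2 (su2Coord)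
open Literature.MathematicalPhysics.QuantumFieldTheory.Balaban1983to89.B10Eq18SigmaSU2Haar (rev)
open Summit.QuantumFields.YangMills.Theorems.FluctuationComparisonRegPrIntLS2BetaChartReadDescentOnto (contDiffAt_chartRead_iter)
open Summit.QuantumFields.YangMills.Theorems.FluctuationComparisonRegPrIntLS2BetaChartReadDescentOntoT3
open Summit.QuantumFields.YangMills.Theorems.FluctuationComparisonRegPrIntLS2BetaChartReadDescentOntoExpPoint

variable {F : T3Family}

/-! ## §1 The T³ log-chart descent: `D(Mc_log)(0) = L_σ ∘ DΨ_{K−J}(0)` -/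

section LogChart

/-- ★★ **`fderiv ℝ Mc_log 0 = L_σ ∘L fderiv ℝ Ψ_{K−J} 0`** (FILE B's `chartRead_descendTo_eq_comp` differentiated: `L_σ` is continuous linear, `Ψ_{K−J}` is `C^∞` at `0` under the guard).
[cite: Balaban1987RG1, (0.1) p.251, (0.11) p.253] -/
theorem fderiv_chartRead_descendTo_eq {J K : ℕ} (hJK : J ≤ K) {θ : ℕ → ℝ} (hθ0 : ∀ i, 0 ≤ θ i)
    (hθδ : ∀ i, J < i → i ≤ K → (((5 * F.L : ℕ) : ℝ) ^ 2 / 4) * θ i < deltaSU (Fin 2))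
    {U₀ : GaugeField (F.P K) 0 (SU 2)} (hUg : U₀ ∈ histGood F ℰp θ K J) :
    fderiv ℝ (fun (A : PBond (F.P K) 0 → (specialUnitaryLogChart (Fin 2)).lie) (B : PBond (F.P J) 0) =>
        (isChartRep_specialUnitaryGroup (n := Fin 2)).logChart
          (descendTo F ℰp J K hJK (fun b => (isChartRep_specialUnitaryGroup (n := Fin 2)).expChart (A b) * U₀ b) B *
            (descendTo F ℰp J K hJK U₀ B)⁻¹)) 0 =
      (ContinuousLinearMap.pi fun B : PBond (F.P J) 0 =>
          ContinuousLinearMap.proj (R := ℝ) (φ := fun _ : PBond (F.P K) (K - J) => (specialUnitaryLogChart (Fin 2)).lie)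
            (bondShift (F.sitesPerDir_eq (m := F.m) (K := J) (j := 0) (m' := F.m) (K' := K) (j' := K - J) (by omega)) B)).comp
        (fderiv ℝ (fun (A : PBond (F.P K) 0 → (specialUnitaryLogChart (Fin 2)).lie) (c : PBond (F.P K) (K - J)) =>
          (isChartRep_specialUnitaryGroup (n := Fin 2)).logChart
            (Averaging.iter (fun i => blockAvg (P := F.P K) (j := i) (expMeanLogSU (n := Fin 2))) (K - J)
                (fun b => (isChartRep_specialUnitaryGroup (n := Fin 2)).expChart (A b) * U₀ b) c *
              (Averaging.iter (fun i => blockAvg (P := F.P K) (j := i) (expMeanLogSU (n := Fin 2))) (K - J) U₀ c)⁻¹)) 0) := by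
  set Ψ := fun (A : PBond (F.P K) 0 → (specialUnitaryLogChart (Fin 2)).lie) (c : PBond (F.P K) (K - J)) =>
      (isChartRep_specialUnitaryGroup (n := Fin 2)).logChart
        (Averaging.iter (fun i => blockAvg (P := F.P K) (j := i) (expMeanLogSU (n := Fin 2))) (K - J)
            (fun b => (isChartRep_specialUnitaryGroup (n := Fin 2)).expChart (A b) * U₀ b) c *
          (Averaging.iter (fun i => blockAvg (P := F.P K) (j := i) (expMeanLogSU (n := Fin 2))) (K - J) U₀ c)⁻¹) with hΨ
  set Lσ := (ContinuousLinearMap.pi fun B : PBond (F.P J) 0 =>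
      ContinuousLinearMap.proj (R := ℝ) (φ := fun _ : PBond (F.P K) (K - J) => (specialUnitaryLogChart (Fin 2)).lie)
        (bondShift (F.sitesPerDir_eq (m := F.m) (K := J) (j := 0) (m' := F.m) (K' := K) (j' := K - J) (by omega)) B)) with hLσ
  rw [chartRead_descendTo_eq_comp (F := F) hJK U₀]
  have hC := contDiffAt_chartRead_iter (P := F.P K) (N := 2) U₀ (K - J) (smallBelow_of_histGood (F := F) hθ0 hθδ hUg)
  have hΨD : HasFDerivAt Ψ (fderiv ℝ Ψ 0) 0 := (hC.differentiableAt (by simp)).hasFDerivAt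
  have hcomp : HasFDerivAt (⇑Lσ ∘ Ψ) (Lσ.comp (fderiv ℝ Ψ 0)) 0 :=
    HasFDerivAt.comp (𝕜 := ℝ) (f := Ψ) (f' := fderiv ℝ Ψ 0) (g := ⇑Lσ) (g' := Lσ) (0 : PBond (F.P K) 0 → (specialUnitaryLogChart (Fin 2)).lie)
      Lσ.hasFDerivAt hΨD
  exact hcomp.fderiv

/-- Pointwise: `(D Mc_log(0) A) B = (DΨ_{K−J}(0) A) (bondShift _ B)`. [cite: Balaban1987RG1, (0.1) p.251, (0.11) p.253] -/
theorem fderiv_chartRead_descendTo_apply {J K : ℕ} (hJK : J ≤ K) {θ : ℕ → ℝ} (hθ0 : ∀ i, 0 ≤ θ i)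
    (hθδ : ∀ i, J < i → i ≤ K → (((5 * F.L : ℕ) : ℝ) ^ 2 / 4) * θ i < deltaSU (Fin 2))
    {U₀ : GaugeField (F.P K) 0 (SU 2)} (hUg : U₀ ∈ histGood F ℰp θ K J)
    (A : PBond (F.P K) 0 → (specialUnitaryLogChart (Fin 2)).lie) (B : PBond (F.P J) 0) :
    fderiv ℝ (fun (A : PBond (F.P K) 0 → (specialUnitaryLogChart (Fin 2)).lie) (B : PBond (F.P J) 0) =>
        (isChartRep_specialUnitaryGroup (n := Fin 2)).logChart
          (descendTo F ℰp J K hJK (fun b => (isChartRep_specialUnitaryGroup (n := Fin 2)).expChart (A b) * U₀ b) B *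
            (descendTo F ℰp J K hJK U₀ B)⁻¹)) 0 A B =
      fderiv ℝ (fun (A : PBond (F.P K) 0 → (specialUnitaryLogChart (Fin 2)).lie) (c : PBond (F.P K) (K - J)) =>
          (isChartRep_specialUnitaryGroup (n := Fin 2)).logChart
            (Averaging.iter (fun i => blockAvg (P := F.P K) (j := i) (expMeanLogSU (n := Fin 2))) (K - J)
                (fun b => (isChartRep_specialUnitaryGroup (n := Fin 2)).expChart (A b) * U₀ b) c *
              (Averaging.iter (fun i => blockAvg (P := F.P K) (j := i) (expMeanLogSU (n := Fin 2))) (K - J) U₀ c)⁻¹)) 0 A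
        (bondShift (F.sitesPerDir_eq (m := F.m) (K := J) (j := 0) (m' := F.m) (K' := K) (j' := K - J) (by omega)) B) := by
  rw [fderiv_chartRead_descendTo_eq (F := F) hJK hθ0 hθδ hUg]
  rfl

end LogChart

/-! ## §2 The door's quaternionic chart: `DM = D(Mc_log)(0) ∘ E` -/

section ExpPointChart

/-- ★★ **`fderiv ℝ Mc 0 = (fderiv ℝ Mc_log 0) ∘L ↑E`** for every coordinate equivalence `E` with `E ζ b = ⟨su2Coord (rev (ζ b)), _⟩` (✓`exists_coordEquiv`; guard only).
[cite: Balaban1985UV3, p.260; Balaban1987RG1, (0.11) p.253] -/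
theorem fderiv_chartRead_descendTo_expPoint_eq {J K : ℕ} (hJK : J ≤ K) {θ : ℕ → ℝ} (hθ0 : ∀ i, 0 ≤ θ i)
    (hθδ : ∀ i, J < i → i ≤ K → (((5 * F.L : ℕ) : ℝ) ^ 2 / 4) * θ i < deltaSU (Fin 2))
    {U₀ : GaugeField (F.P K) 0 (SU 2)} (hUg : U₀ ∈ histGood F ℰp θ K J)
    (E : (PBond (F.P K) 0 → EuclideanSpace ℝ (Fin 3)) ≃L[ℝ] (PBond (F.P K) 0 → (specialUnitaryLogChart (Fin 2)).lie))
    (hE : ∀ (ζ : PBond (F.P K) 0 → EuclideanSpace ℝ (Fin 3)) (b : PBond (F.P K) 0),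
      E ζ b = (⟨su2Coord (rev (ζ b)), su2Coord_rev_mem_lie (ζ b)⟩ : (specialUnitaryLogChart (Fin 2)).lie)) :
    fderiv ℝ (fun (ζ : PBond (F.P K) 0 → EuclideanSpace ℝ (Fin 3)) (B : PBond (F.P J) 0) =>
        (isChartRep_specialUnitaryGroup (n := Fin 2)).logChart
          (descendTo F ℰp J K hJK (fun ℓ => expPoint (ζ ℓ) * U₀ ℓ) B * (descendTo F ℰp J K hJK U₀ B)⁻¹)) 0 =
      (fderiv ℝ (fun (A : PBond (F.P K) 0 → (specialUnitaryLogChart (Fin 2)).lie) (B : PBond (F.P J) 0) =>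
          (isChartRep_specialUnitaryGroup (n := Fin 2)).logChart
            (descendTo F ℰp J K hJK (fun b => (isChartRep_specialUnitaryGroup (n := Fin 2)).expChart (A b) * U₀ b) B *
              (descendTo F ℰp J K hJK U₀ B)⁻¹)) 0).comp
        (E : (PBond (F.P K) 0 → EuclideanSpace ℝ (Fin 3)) →L[ℝ] (PBond (F.P K) 0 → (specialUnitaryLogChart (Fin 2)).lie)) := by
  set Mlog := fun (A : PBond (F.P K) 0 → (specialUnitaryLogChart (Fin 2)).lie) (B : PBond (F.P J) 0) =>
      (isChartRep_specialUnitaryGroup (n := Fin 2)).logChart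
        (descendTo F ℰp J K hJK (fun b => (isChartRep_specialUnitaryGroup (n := Fin 2)).expChart (A b) * U₀ b) B *
          (descendTo F ℰp J K hJK U₀ B)⁻¹) with hMlog
  have hEfun : (fun (ζ : PBond (F.P K) 0 → EuclideanSpace ℝ (Fin 3)) (b : PBond (F.P K) 0) =>
      (⟨su2Coord (rev (ζ b)), su2Coord_rev_mem_lie (ζ b)⟩ : (specialUnitaryLogChart (Fin 2)).lie)) = ⇑E := by
    funext ζ b; exact (hE ζ b).symm
  rw [chartRead_descendTo_expPoint_eq_comp (F := F) hJK U₀, hEfun]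
  have hC := contDiffAt_chartRead_descendTo (F := F) hJK hθ0 hθδ hUg
  have hE0 : E 0 = 0 := map_zero E
  have hMD : HasFDerivAt Mlog (fderiv ℝ Mlog 0) (E 0) := by rw [hE0]; exact (hC.differentiableAt (by simp)).hasFDerivAt
  have hED : HasFDerivAt (⇑E) (E : (PBond (F.P K) 0 → EuclideanSpace ℝ (Fin 3)) →L[ℝ] (PBond (F.P K) 0 → (specialUnitaryLogChart (Fin 2)).lie)) 0 :=
    ContinuousLinearEquiv.hasFDerivAt (𝕜 := ℝ) (E := PBond (F.P K) 0 → EuclideanSpace ℝ (Fin 3))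
      (F := PBond (F.P K) 0 → (specialUnitaryLogChart (Fin 2)).lie) (x := 0) E
  have hcomp : HasFDerivAt (Mlog ∘ ⇑E) ((fderiv ℝ Mlog 0).comp (E : (PBond (F.P K) 0 → EuclideanSpace ℝ (Fin 3)) →L[ℝ]
      (PBond (F.P K) 0 → (specialUnitaryLogChart (Fin 2)).lie))) 0 :=
    HasFDerivAt.comp (𝕜 := ℝ) (f := ⇑E) (f' := (E : (PBond (F.P K) 0 → EuclideanSpace ℝ (Fin 3)) →L[ℝ]
      (PBond (F.P K) 0 → (specialUnitaryLogChart (Fin 2)).lie))) (g := Mlog) (g' := fderiv ℝ Mlog 0)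
      (0 : PBond (F.P K) 0 → EuclideanSpace ℝ (Fin 3)) hMD hED
  exact hcomp.fderiv

/-- ★★★ **THE PINNED `DM`, POINTWISE, WITHOUT `E`**: `(DM ζ) B = (DΨ_{K−J}(0) (b ↦ ⟨su2Coord (rev (ζ b)), _⟩)) (bondShift _ B)` for every good history `U₀` (guard only) — the
door's derivative on a direction `ζ : bonds_K → ℝ³` IS ✓p823800's k-step chart-read derivative on the Pauli coordinates of `ζ`, read at the identified coarse bond.
[cite: Balaban1985UV3, p.260; Balaban1987RG1, (0.1) p.251, (0.11) p.253] -/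
theorem fderiv_chartRead_descendTo_expPoint_apply {J K : ℕ} (hJK : J ≤ K) {θ : ℕ → ℝ} (hθ0 : ∀ i, 0 ≤ θ i)
    (hθδ : ∀ i, J < i → i ≤ K → (((5 * F.L : ℕ) : ℝ) ^ 2 / 4) * θ i < deltaSU (Fin 2))
    {U₀ : GaugeField (F.P K) 0 (SU 2)} (hUg : U₀ ∈ histGood F ℰp θ K J)
    (ζ : PBond (F.P K) 0 → EuclideanSpace ℝ (Fin 3)) (B : PBond (F.P J) 0) :
    fderiv ℝ (fun (ζ : PBond (F.P K) 0 → EuclideanSpace ℝ (Fin 3)) (B : PBond (F.P J) 0) =>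
        (isChartRep_specialUnitaryGroup (n := Fin 2)).logChart
          (descendTo F ℰp J K hJK (fun ℓ => expPoint (ζ ℓ) * U₀ ℓ) B * (descendTo F ℰp J K hJK U₀ B)⁻¹)) 0 ζ B =
      fderiv ℝ (fun (A : PBond (F.P K) 0 → (specialUnitaryLogChart (Fin 2)).lie) (c : PBond (F.P K) (K - J)) =>
          (isChartRep_specialUnitaryGroup (n := Fin 2)).logChart
            (Averaging.iter (fun i => blockAvg (P := F.P K) (j := i) (expMeanLogSU (n := Fin 2))) (K - J)
                (fun b => (isChartRep_specialUnitaryGroup (n := Fin 2)).expChart (A b) * U₀ b) c *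
              (Averaging.iter (fun i => blockAvg (P := F.P K) (j := i) (expMeanLogSU (n := Fin 2))) (K - J) U₀ c)⁻¹)) 0
        (fun b => (⟨su2Coord (rev (ζ b)), su2Coord_rev_mem_lie (ζ b)⟩ : (specialUnitaryLogChart (Fin 2)).lie))
        (bondShift (F.sitesPerDir_eq (m := F.m) (K := J) (j := 0) (m' := F.m) (K' := K) (j' := K - J) (by omega)) B) := by
  obtain ⟨E, hE⟩ := exists_coordEquiv (F.P K) 0
  rw [fderiv_chartRead_descendTo_expPoint_eq (F := F) hJK hθ0 hθδ hUg E hE, ContinuousLinearMap.comp_apply,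
    fderiv_chartRead_descendTo_apply (F := F) hJK hθ0 hθδ hUg]
  have hEζ : (E : (PBond (F.P K) 0 → EuclideanSpace ℝ (Fin 3)) →L[ℝ] (PBond (F.P K) 0 → (specialUnitaryLogChart (Fin 2)).lie)) ζ =
      fun b => (⟨su2Coord (rev (ζ b)), su2Coord_rev_mem_lie (ζ b)⟩ : (specialUnitaryLogChart (Fin 2)).lie) := by
    funext b; exact hE ζ b
  rw [hEζ]

end ExpPointChart

end Summit.QuantumFields.YangMills.Theorems.FluctuationComparisonRegPrIntLS2BetaChartReadDescentDerivFactorisation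

end
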